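import Mathlib
import Literature.Analysis.FluidPDE.Tao2016AveragedNS.ShiftSetCascadeFlows
import Literature.Analysis.FluidPDE.Tao2016AveragedNS.ShiftSetCascadeFlux
import Summits.NavierStokesRegularity.NavierStokesRegularity.Theorems.TaoLadderRungTwoFlatCertificateGlueCheckerLandPOn
import Summits.NavierStokesRegularity.NavierStokesRegularity.Theorems.TaoLadderRungTwoFlatCertificateGlueCheckerStepJOn
import HarnessLib

/-!
# Certificate glue on a shift set `𝕊`, XXXVIII-e: SECTION READOUT, TRAPPING AND LANDING FROM BRANCH CHAINS CHECKED WITH `checkStepGJ` — glue XXXIV-e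
  (`stepRead_para_of_checksG`, `stepRead_readoutL_of_checksG`) and XXXV-c (`htrap_of_chainChecksP`, `hland_of_chainChecksL`) with the per-step Boolean
  `checkStepG` replaced by the sparse-Jacobian twin `checkStepGJ` of glue XXXVIII-d; statements otherwise VERBATIM (helper for items
  stmt-NavierStokesRegularity-22987 `FlatGapCertificatesV2` (crux K_A♭ of route TaoLadderRungTwoFlat) and stmt-24295 K_A₂(64); cell harvest/h2-tao-ladder, p1 g18;
  PERFORMANCE refactor of the step checker)

HONEST FRAMING: Tao-type MODEL lattices (Tao 2016 §4/§6 vocabulary, shift-set parametrised); checker soundness — NO certificate instance exists in the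
tree, nothing is certified here, no stub is closed, nothing here is a statement about the Navier–Stokes equations.
-/

-- the sub-problem namespace repeats the summit name by design (D-0017)
set_option linter.dupNamespace false

namespace Summit.NavierStokesRegularity.NavierStokesRegularity.Theorems

open Set Filter Topology Finset Literature.Analysis.FluidPDE Literature.Analysis.FluidPDE.TaoCascade
open Summit.NavierStokesRegularity.NavierStokesRegularity.Theorems.TaylorModelCert

namespace CertificateGlueOn

variable {m : ℕ} {𝕊 : Finset (ℤ × ℤ × ℤ)} {ε₀ : ℝ} {α : Fin m → Fin m → Fin m → ℤ × ℤ × ℤ → ℝ} {Kb Ka : ℤ}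
  {Eb Et : ℝ} {M : ℤ → ℝ}

/-! ### Section readout along trajectories, from `checkStepGJ` -/

/-- **`StepRead` INTO THE SECTION-NODE PARALLELEPIPED FROM THE BOOLEANS (GENERIC TABLE)**: `checkGlobalG`, `checkStepGJ … j` and `checkSection` ⇒
every run from `nodeOfV rec j` of length `≤ h j`, read where `sec_q(pxcoord y) = lev`, lies in `PInParaV x* C* r E*` (`x*`, `C*`, `E*` the section-node
centre / frame / remainder of glue XXX built from the record, `E*` from the remainder VECTOR `(rec j).E`).
[cite: Zgliczynski2002C1Lohner, §3–4 (Lohner-type parallelepiped sets; section maps); cell certificate format, section checker, vector remainder] -/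
theorem stepRead_para_of_checksGJ (hKb : 0 ≤ Kb) (hKa : 1 ≤ Ka) {shifts : List (ℤ × ℤ × ℤ)} (hnd : shifts.Nodup)
    (h𝕊 : IsNearestNeighbourSet shifts.toFinset) {q : ℚ}
    {αq : Fin m → Fin m → Fin m → ℤ × ℤ × ℤ → ℚ} {ωq : Fin m → ℤ → ℚ} (hω : ∀ i k, 0 < ωq i k)
    {cB : Fin m → ℤ → Fin m → Fin m → ℤ × ℤ × ℤ → IntervalD}
    (hcoef : CoefBoxOK shifts (q : ℝ) (fun i₁ i₂ i μ => (αq i₁ i₂ i μ : ℝ)) Kb Ka (fun i k => (ωq i k : ℝ)) cB)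
    {prec p kexp nexp : ℕ} {Sp Sm : IntervalD} {bD : Dyad} {Eb Et lev : ℚ} {M : ℤ → ℝ} {rec : ℕ → VRec}
    {qz : Array ℤ} {sr : SecRec} {j : ℕ}
    (hg : checkGlobalG m Kb Ka prec shifts cB q Sp Sm bD = true)
    (hs : checkStepGJ m Kb Ka prec p kexp nexp shifts cB αq ωq Sp Sm bD Eb Et rec j = true)
    (hsec : checkSection m Kb Ka prec shifts (cB) qz (rec j).lo (rec j).hi (rec j).δ sr = true) :
    let n := m * winLen Kb Ka
    let ω : Fin m → ℤ → ℝ := fun i k => (ωq i k : ℝ)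
    StepRead shifts.toFinset (q : ℝ) (fun i₁ i₂ i μ => (αq i₁ i₂ i μ : ℝ)) Kb Ka (Eb : ℝ) (Et : ℝ) M (tOfV rec) (nodeOfV Kb Ka ωq rec)
      (fun y => secQ (qvec (n := n) qz) (pxcoord Kb Ka ω y) = (lev : ℝ) →
        PInParaV Kb Ka ω
          (secCentre (qvec (n := n) qz) (dvec (n := n) sr.p) (dvec (n := n) sr.f) (dvec (n := n) (rec j).x) (lev : ℝ))
          (secFrame (qvec (n := n) qz) (dvec (n := n) sr.p) (dvec (n := n) sr.f) (dmat (n := n) (rec j).C))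
          (dvec (n := n) (rec j).r)
          (secErr (qvec (n := n) qz) (dvec (n := n) sr.p) (dvec (n := n) sr.κ) (dvec (n := n) (rec j).E) (dvec (n := n) sr.Φ)
            ((rec j).h : ℝ) (secQmax (qvec (n := n) qz) (dvec (n := n) sr.W))) y) j := by
  intro n ω
  have hg' := hg
  simp only [checkGlobalG, Bool.and_eq_true, decide_eq_true_eq, Dyad.ble_iff, Dyad.toReal_ofInt, Int.cast_zero] at hg'
  obtain ⟨⟨⟨⟨hSp, hSm⟩, hq⟩, -⟩, -⟩ := hg'
  have hs' := hs
  simp only [checkStepGJ, Bool.and_eq_true, decide_eq_true_eq, Dyad.ble_iff, Dyad.toReal_ofInt, Int.cast_zero] at hs'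
  obtain ⟨⟨⟨⟨⟨⟨⟨⟨⟨⟨⟨⟨⟨⟨-, -⟩, hAA'⟩, -⟩, -⟩, -⟩, -⟩, -⟩, -⟩, -⟩, -⟩, h13⟩, -⟩, h11⟩, -⟩ := hs'
  have hq' : 0 < 1 + (q : ℝ) := by
    have : ((-1 : ℚ) : ℝ) < (q : ℝ) := by exact_mod_cast hq
    push_cast at this; linarith
  have hω' : ∀ i k, (0 : ℝ) < ω i k := fun i k => show (0 : ℝ) < (ωq i k : ℝ) by exact_mod_cast hω i k
  have hstep := stepCert_of_checkStepGJ (M := M) hKb hKa hnd h𝕊 hω hcoef hg hs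
  have hdef := pinputDefect_of_checkDefectT prec hnd h𝕊 hq' hω hSp hSm h11
  have hrange := fieldRangeOn_of_pqBox (Eb := (Eb : ℝ)) (Et := (Et : ℝ)) hKb hKa hω' hnd hcoef prec hdef
  obtain ⟨hd, hκ, hF, hΦ, hW⟩ := section_hyps_of_check (prec := prec) (shifts := shifts) (coefB := cB) hKb hKa hω hsec
  exact stepRead_para_of_sectionNodeV hKb hKa hω' hstep (fun y hy => hy) (fun y hy => inBox_of_hullOfG hnd hω hAA'.le h13 hy) hrange
    (tOfV_succ_sub rec j).le hd hκ hF hΦ hW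

/-- **`StepRead` WITH THE READOUT CLAUSE FROM THE BOOLEANS, READOUT-L**: `checkGlobalG`, `checkStepGJ … j`, `checkSection` and `checkReadoutL` on the
tabulated section-node PARALLELEPIPED (`xsArr`, `csArr`, `(rec j).r`, `esArr`) ⇒ `StepRead` with exactly the readout property `hread` of glue XXXI
`hland_of_branchMeshes'` (`sec y := secQ q (pxcoord y)`, `w := wq`, `ε₀ := q`, `θ₀ := θn/θd`), given `InCoreBox ⊆ Core`.
[cite: Tao2016AveragedNS, §6.3–6.4 Props. 6.4–6.5 (statement shape; the readout clauses); cell certificate format, readout checker L] -/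
theorem stepRead_readoutL_of_checksGJ (hKb : 0 ≤ Kb) (hKa : 1 ≤ Ka) {shifts : List (ℤ × ℤ × ℤ)} (hnd : shifts.Nodup)
    (h𝕊 : IsNearestNeighbourSet shifts.toFinset) {q : ℚ} (hq : 0 < 1 + (q : ℝ))
    {αq : Fin m → Fin m → Fin m → ℤ × ℤ × ℤ → ℚ} {ωq : Fin m → ℤ → ℚ} (hω : ∀ i k, 0 < ωq i k)
    {cB : Fin m → ℤ → Fin m → Fin m → ℤ × ℤ × ℤ → IntervalD}
    (hcoef : CoefBoxOK shifts (q : ℝ) (fun i₁ i₂ i μ => (αq i₁ i₂ i μ : ℝ)) Kb Ka (fun i k => (ωq i k : ℝ)) cB)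
    {prec p kexp nexp : ℕ} {Sp Sm : IntervalD} {bD : Dyad} {Eb Et lev : ℚ} {M : ℤ → ℝ} {rec : ℕ → VRec}
    {qz : Array ℤ} {sr : SecRec} {j : ℕ} {Core : (Fin m → ℤ → ℝ) → Prop}
    {i₀ : Fin m} {σ ρ r Zx Et' Cs : ℚ} {θn θd : ℕ} {wq : ℤ → ℚ} {ell cen chw : Array Dyad}
    (hg : checkGlobalG m Kb Ka prec shifts cB q Sp Sm bD = true)
    (hs : checkStepGJ m Kb Ka prec p kexp nexp shifts cB αq ωq Sp Sm bD Eb Et rec j = true)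
    (hsec : checkSection m Kb Ka prec shifts (cB) qz (rec j).lo (rec j).hi (rec j).δ sr = true)
    (hread : checkReadoutL m Kb Ka ωq i₀ q σ ρ r Zx Et' θn θd wq Cs ell cen chw (xsArr (m * winLen Kb Ka) qz sr (rec j).x lev)
      (csArr (m * winLen Kb Ka) qz sr (rec j).C) (rec j).r (esArr (m * winLen Kb Ka) qz sr (rec j).E (rec j).h) = true)
    (hcoreL : ∀ z : Fin m → ℤ → ℝ, InCoreBox Kb Ka Cs cen chw z → Core z) :
    StepRead shifts.toFinset (q : ℝ) (fun i₁ i₂ i μ => (αq i₁ i₂ i μ : ℝ)) Kb Ka (Eb : ℝ) (Et : ℝ) M (tOfV rec) (nodeOfV Kb Ka ωq rec)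
      (fun y => secQ (qvec (n := m * winLen Kb Ka) qz) (pxcoord Kb Ka (fun i k => (ωq i k : ℝ)) y) = (lev : ℝ) →
        ∃ (a' : ℝ) (z' : Fin m → ℤ → ℝ), 0 < a' ∧ (1 + (q : ℝ)) ^ (-((θn : ℝ) / (θd : ℝ))) ≤ a' ∧
          (1 + (σ : ℝ)) * a' ≤ |y i₀ 1| ∧ Core z' ∧
          (∀ i k, -Kb ≤ k → k + 1 ≤ Ka → (wq k : ℝ) * |y i (1 + k) / a' - z' i k| ≤ (ρ : ℝ) * (r : ℝ)) ∧
          (∀ (i : Fin m) (v : ℝ), |v| ≤ (Et' : ℝ) → (wq Ka : ℝ) * |v / a' - z' i Ka| ≤ (ρ : ℝ) * (r : ℝ)) ∧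
          (∀ i, |y i (-Kb)| ≤ a' * (Zx : ℝ))) j := by
  have hSR := stepRead_para_of_checksGJ (M := M) (lev := lev) hKb hKa hnd h𝕊 hω hcoef hg hs hsec
  refine stepRead_mono hSR fun y hP hlev => ?_
  have hpara := hP hlev
  refine read_of_checkReadoutL hKb hKa hω hq hread hcoreL ?_
  have hX : (fun c : Fin (m * winLen Kb Ka) => ((xsArr (m * winLen Kb Ka) qz sr (rec j).x lev).getD c 0 : ℝ)) =
      secCentre (qvec (n := m * winLen Kb Ka) qz) (dvec (n := m * winLen Kb Ka) sr.p) (dvec (n := m * winLen Kb Ka) sr.f)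
        (dvec (n := m * winLen Kb Ka) (rec j).x) (lev : ℝ) := by
    funext c; unfold xsArr; rw [getD_ofFn, cast_xsQ]
  have hC : (Matrix.of fun c col : Fin (m * winLen Kb Ka) => (qmgetD (csArr (m * winLen Kb Ka) qz sr (rec j).C) c col : ℝ)) =
      secFrame (qvec (n := m * winLen Kb Ka) qz) (dvec (n := m * winLen Kb Ka) sr.p) (dvec (n := m * winLen Kb Ka) sr.f)
        (dmat (n := m * winLen Kb Ka) (rec j).C) := by
    ext c col; rw [Matrix.of_apply, cast_csArr]
  have hE : (fun c : Fin (m * winLen Kb Ka) => ((esArr (m * winLen Kb Ka) qz sr (rec j).E (rec j).h).getD c 0 : ℝ)) =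
      secErr (qvec (n := m * winLen Kb Ka) qz) (dvec (n := m * winLen Kb Ka) sr.p) (dvec (n := m * winLen Kb Ka) sr.κ)
        (dvec (n := m * winLen Kb Ka) (rec j).E) (dvec (n := m * winLen Kb Ka) sr.Φ) ((rec j).h : ℝ)
        (secQmax (qvec (n := m * winLen Kb Ka) qz) (dvec (n := m * winLen Kb Ka) sr.W)) := by
    funext c; rw [cast_esArr]
  have hr : (fun col : Fin (m * winLen Kb Ka) => (dgetD (rec j).r col).toReal) = dvec (n := m * winLen Kb Ka) (rec j).r := rfl
  rw [hX, hC, hE, hr]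
  exact hpara


/-! ### The trapping and landing clauses from branch chains with per-branch gauges, from `checkStepGJ` -/

variable {ι : Type*} {Core : (Fin m → ℤ → ℝ) → Prop}

/-- **THE TRAPPING CLAUSE `htrap` FROM CHECKED TRANSIT BRANCH CHAINS, PER-BRANCH GAUGE**: glue XXIX-d `htrap_of_chainChecksG` with the weights `ωq b`,
the coefficient table `cB b`, `prec b`, `p b` and `Sp b, Sm b, bD b` indexed by the branch (`checkGlobalG` once per branch); the cover maps a core state
to the weighted start box of a branch in THAT branch's gauge.
[cite: Tao2016AveragedNS, §6.3–6.4 Props. 6.4–6.5 (statement shape of a renormalisation certificate); cell certificate format, branch checker, per-branch gauge] -/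
theorem htrap_of_chainChecksPJ {w : ℤ → ℝ} {r : ℝ} (hKb : 0 ≤ Kb) (hKa : 1 ≤ Ka) {shifts : List (ℤ × ℤ × ℤ)} (hnd : shifts.Nodup)
    (h𝕊 : IsNearestNeighbourSet shifts.toFinset) {q : ℚ} {cB : ι → Fin m → ℤ → Fin m → Fin m → ℤ × ℤ × ℤ → IntervalD}
    {αq : Fin m → Fin m → Fin m → ℤ × ℤ × ℤ → ℚ} {ωq : ι → Fin m → ℤ → ℚ} (hω : ∀ b i k, 0 < ωq b i k)
    (hcoef : ∀ b, CoefBoxOK shifts (q : ℝ) (fun i₁ i₂ i μ => (αq i₁ i₂ i μ : ℝ)) Kb Ka (fun i k => (ωq b i k : ℝ)) (cB b))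
    {prec p : ι → ℕ} {kexp nexp : ℕ} {Sp Sm : ι → IntervalD} {bD : ι → Dyad} {Eb Et c : ℚ} {Mq : ℤ → ℚ}
    {rec : ι → ℕ → VRec} {N : ι → ℕ}
    (hg : ∀ b, checkGlobalG m Kb Ka (prec b) shifts (cB b) q (Sp b) (Sm b) (bD b) = true)
    (hs : ∀ b j, j < N b → checkStepGJ m Kb Ka (prec b) (p b) kexp nexp shifts (cB b) αq (ωq b) (Sp b) (Sm b) (bD b) Eb Et (rec b) j = true)
    (htr : ∀ b j, j < N b → checkTransit m Kb Ka (ωq b) Mq (rec b j).lo (rec b j).hi = true)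
    (hc : ∀ b, c ≤ sumHV (rec b) (N b))
    (hid : ∀ b, checkIdFrame (m * winLen Kb Ka) (rec b 0).C = true) (hE : ∀ b, checkNonneg (m * winLen Kb Ka) (rec b 0).E = true)
    (hcover : ∀ (z S₀ : Fin m → ℤ → ℝ), Core z → (∀ i k, -Kb ≤ k → k ≤ Ka → w k * |S₀ i k - z i k| ≤ r) →
      ∃ b, ∀ d, |pxcoord Kb Ka (fun i k => (ωq b i k : ℝ)) S₀ d - dvec (n := m * winLen Kb Ka) (rec b 0).x d| ≤
        dvec (n := m * winLen Kb Ka) (rec b 0).r d) :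
    ∀ (s : ℝ) (z : Fin m → ℤ → ℝ) (S : Fin m → ℤ → ℝ → ℝ), Core z → 0 < s → s ≤ (c : ℝ) →
      (∀ i k, -Kb ≤ k → k ≤ Ka → w k * |S i k 0 - z i k| ≤ r) →
      (∀ i k, -Kb ≤ k → k ≤ Ka → ∀ u ∈ Icc 0 s,
        HasDerivWithinAt (S i k) (quadTermOn shifts.toFinset (q : ℝ) (fun i₁ i₂ i μ => (αq i₁ i₂ i μ : ℝ)) S i k u) (Icc 0 s) u) →
      (∀ i, ContinuousOn (S i (-Kb - 1)) (Icc 0 s)) → (∀ i, ContinuousOn (S i (Ka + 1)) (Icc 0 s)) →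
      (∀ i, ∀ u ∈ Icc 0 s, |S i (-Kb - 1) u| ≤ (Eb : ℝ)) →
      (∀ i, ∀ u ∈ Icc 0 s, |S i (Ka + 1) u| ≤ (Et : ℝ)) →
      (∀ i k, -Kb ≤ k → k ≤ Ka → ∀ u ∈ Icc 0 s, |S i k u| ≤ (Mq k : ℝ)) →
        ∀ i k, -Kb ≤ k → k ≤ Ka → ∀ u ∈ Icc 0 s, |S i k u| < (Mq k : ℝ) := by
  have hbr := fun b => transitBranchGJ_of_checks hKb hKa hnd h𝕊 (hω b) (hcoef b) (hg b) (hs b) (htr b)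
  exact htrap_of_branchMeshes
    (Box := fun b S₀ => ∀ d, |pxcoord Kb Ka (fun i k => (ωq b i k : ℝ)) S₀ d - dvec (n := m * winLen Kb Ka) (rec b 0).x d| ≤
      dvec (n := m * winLen Kb Ka) (rec b 0).r d)
    (t := fun b => tOfV (rec b)) (Node := fun b => nodeOfV Kb Ka (ωq b) (rec b))
    (Hull := fun b => hullOfG Kb Ka shifts (cB b) (ωq b) (rec b))
    hcover (fun b => (hbr b).1) (fun b => (hbr b).2.1) (fun b => le_tOfV_of_le_sumHV (hc b))
    (fun b y hy => node0_of_boxV (hid b) (hE b) hy) (fun b => (hbr b).2.2.1) (fun b => (hbr b).2.2.2)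

/-- **THE LANDING CLAUSE `hland` FROM CHECKED BRANCH CHAINS, PER-BRANCH GAUGE, READOUT-L.** Per branch `b`: its own weights `ωq b`, table `cB b`,
section weights `qz b` / level `lev b`, records `rec b` with `checkStepGJ` for `j ≤ j₂ b`, readout steps `j₁ b ≤ j ≤ j₂ b` each with a section record
(`checkSection`) and a READOUT-L test `checkReadoutL` on the tabulated section-node parallelepiped against the fat core box `(Cs b j, cen b j, chw b j)`
(every such box inside `Core`), the sign tests `checkSecBelow` / `checkSecAbove`, the clocks, the identity start frame; and the fattened core covered by
the weighted start boxes (branch `b`'s own gauge) ⇒ the clause `hland` of glue IV verbatim (`w := wq`, `θ₀ := θn/θd`).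
[cite: Tao2016AveragedNS, §6.3–6.4 Props. 6.4–6.5 (statement shape of a renormalisation certificate; the readout at the crossing); cell certificate format, landing checker L, per-branch gauge] -/
theorem hland_of_chainChecksLJ {wq : ℤ → ℚ} {r : ℚ} (hKb : 0 ≤ Kb) (hKa : 1 ≤ Ka) {shifts : List (ℤ × ℤ × ℤ)} (hnd : shifts.Nodup)
    (h𝕊 : IsNearestNeighbourSet shifts.toFinset) {q : ℚ} (hq : 0 < 1 + (q : ℝ))
    {αq : Fin m → Fin m → Fin m → ℤ × ℤ × ℤ → ℚ} {ωq : ι → Fin m → ℤ → ℚ} (hω : ∀ b i k, 0 < ωq b i k)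
    {cB : ι → Fin m → ℤ → Fin m → Fin m → ℤ × ℤ × ℤ → IntervalD}
    (hcoef : ∀ b, CoefBoxOK shifts (q : ℝ) (fun i₁ i₂ i μ => (αq i₁ i₂ i μ : ℝ)) Kb Ka (fun i k => (ωq b i k : ℝ)) (cB b))
    {prec p : ι → ℕ} {kexp nexp : ℕ} {Sp Sm : ι → IntervalD} {bD : ι → Dyad} {Eb Et c₀ : ℚ} {Mq : ℤ → ℚ}
    {rec : ι → ℕ → VRec} {j₁ j₂ : ι → ℕ} {sr : ι → ℕ → SecRec} {qz : ι → Array ℤ} {lev : ι → ℚ}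
    {i₀ : Fin m} {σ ρ Zx : ℚ} {θn θd : ℕ} {Cs : ι → ℕ → ℚ} {ell cen chw : ι → ℕ → Array Dyad}
    (hg : ∀ b, checkGlobalG m Kb Ka (prec b) shifts (cB b) q (Sp b) (Sm b) (bD b) = true)
    (hj : ∀ b, j₁ b ≤ j₂ b)
    (hs : ∀ b j, j < j₂ b + 1 → checkStepGJ m Kb Ka (prec b) (p b) kexp nexp shifts (cB b) αq (ωq b) (Sp b) (Sm b) (bD b) Eb Et (rec b) j = true)
    (hsec : ∀ b j, j₁ b ≤ j → j ≤ j₂ b →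
      checkSection m Kb Ka (prec b) shifts (cB b) (qz b) (rec b j).lo (rec b j).hi (rec b j).δ (sr b j) = true)
    (hread : ∀ b j, j₁ b ≤ j → j ≤ j₂ b →
      checkReadoutL m Kb Ka (ωq b) i₀ q σ ρ r Zx Et θn θd wq (Cs b j) (ell b j) (cen b j) (chw b j)
        (xsArr (m * winLen Kb Ka) (qz b) (sr b j) (rec b j).x (lev b)) (csArr (m * winLen Kb Ka) (qz b) (sr b j) (rec b j).C) (rec b j).r
        (esArr (m * winLen Kb Ka) (qz b) (sr b j) (rec b j).E (rec b j).h) = true)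
    (hcoreL : ∀ b j, j₁ b ≤ j → j ≤ j₂ b → ∀ z : Fin m → ℤ → ℝ, InCoreBox Kb Ka (Cs b j) (cen b j) (chw b j) z → Core z)
    (hbefore : ∀ b, checkSecBelow (m * winLen Kb Ka) (qz b) (rec b (j₁ b)) (lev b) = true)
    (hafter : ∀ b, checkSecAbove (m * winLen Kb Ka) (qz b) (rec b (j₂ b + 1)) (lev b) = true)
    (hpos : ∀ b, 0 < sumHV (rec b) (j₁ b)) (hc₀ : ∀ b, sumHV (rec b) (j₂ b + 1) ≤ c₀)
    (hid : ∀ b, checkIdFrame (m * winLen Kb Ka) (rec b 0).C = true) (hE : ∀ b, checkNonneg (m * winLen Kb Ka) (rec b 0).E = true)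
    (hcover : ∀ (z S₀ : Fin m → ℤ → ℝ), Core z → (∀ i k, -Kb ≤ k → k ≤ Ka → (wq k : ℝ) * |S₀ i k - z i k| ≤ (r : ℝ)) →
      ∃ b, ∀ d, |pxcoord Kb Ka (fun i k => (ωq b i k : ℝ)) S₀ d - dvec (n := m * winLen Kb Ka) (rec b 0).x d| ≤
        dvec (n := m * winLen Kb Ka) (rec b 0).r d) :
    ∀ (z : Fin m → ℤ → ℝ) (S : Fin m → ℤ → ℝ → ℝ), Core z →
      (∀ i k, -Kb ≤ k → k ≤ Ka → (wq k : ℝ) * |S i k 0 - z i k| ≤ (r : ℝ)) →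
      (∀ i k, -Kb ≤ k → k ≤ Ka → ∀ u ∈ Icc 0 (c₀ : ℝ),
        HasDerivWithinAt (S i k) (quadTermOn shifts.toFinset (q : ℝ) (fun i₁ i₂ i μ => (αq i₁ i₂ i μ : ℝ)) S i k u) (Icc 0 (c₀ : ℝ)) u) →
      (∀ i, ContinuousOn (S i (-Kb - 1)) (Icc 0 (c₀ : ℝ))) → (∀ i, ContinuousOn (S i (Ka + 1)) (Icc 0 (c₀ : ℝ))) →
      (∀ i, ∀ u ∈ Icc 0 (c₀ : ℝ), |S i (-Kb - 1) u| ≤ (Eb : ℝ)) →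
      (∀ i, ∀ u ∈ Icc 0 (c₀ : ℝ), |S i (Ka + 1) u| ≤ (Et : ℝ)) →
      (∀ i k, -Kb ≤ k → k ≤ Ka → ∀ u ∈ Icc 0 (c₀ : ℝ), |S i k u| ≤ (Mq k : ℝ)) →
        ∃ (τ₁ a' : ℝ) (z' : Fin m → ℤ → ℝ), 0 < τ₁ ∧ τ₁ ≤ (c₀ : ℝ) ∧ 0 < a' ∧ (1 + (q : ℝ)) ^ (-((θn : ℝ) / (θd : ℝ))) ≤ a' ∧
          (1 + (σ : ℝ)) * a' ≤ |S i₀ 1 τ₁| ∧ Core z' ∧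
          (∀ i k, -Kb ≤ k → k + 1 ≤ Ka → (wq k : ℝ) * |S i (1 + k) τ₁ / a' - z' i k| ≤ (ρ : ℝ) * (r : ℝ)) ∧
          (∀ (i : Fin m) (v : ℝ), |v| ≤ (Et : ℝ) → (wq Ka : ℝ) * |v / a' - z' i Ka| ≤ (ρ : ℝ) * (r : ℝ)) ∧
          (∀ i, |S i (-Kb) τ₁| ≤ a' * (Zx : ℝ)) := by
  have hstep : ∀ b j, j < j₂ b + 1 → StepCert shifts.toFinset (q : ℝ) (fun i₁ i₂ i μ => (αq i₁ i₂ i μ : ℝ)) Kb Ka (Eb : ℝ) (Et : ℝ)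
      (fun k => (Mq k : ℝ)) (tOfV (rec b)) (nodeOfV Kb Ka (ωq b) (rec b)) (hullOfG Kb Ka shifts (cB b) (ωq b) (rec b)) j :=
    fun b j hjb => stepCert_of_checkStepGJ hKb hKa hnd h𝕊 (hω b) (hcoef b) (hg b) (hs b j hjb)
  have hmono : ∀ b j, j < j₂ b + 1 → tOfV (rec b) j < tOfV (rec b) (j + 1) := by
    intro b j hjb
    have h := hs b j hjb
    simp only [checkStepGJ, Bool.and_eq_true, decide_eq_true_eq] at h
    exact tOfV_lt_succ h.1.1.1.1.1.1.1.1.1.1.1.2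
  have hpos' : ∀ b, 0 < tOfV (rec b) (j₁ b) := fun b => by
    have : ((0 : ℚ) : ℝ) < ((sumHV (rec b) (j₁ b) : ℚ) : ℝ) := by exact_mod_cast hpos b
    have e : tOfV (rec b) (j₁ b) = ((sumHV (rec b) (j₁ b) : ℚ) : ℝ) := by simp [tOfV, sumHV]
    rw [e]; simpa using this
  have hc₀' : ∀ b, tOfV (rec b) (j₂ b + 1) ≤ (c₀ : ℝ) := fun b => by
    have e : tOfV (rec b) (j₂ b + 1) = ((sumHV (rec b) (j₂ b + 1) : ℚ) : ℝ) := by simp [tOfV, sumHV]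
    rw [e]; exact_mod_cast hc₀ b
  have hread' : ∀ b j, j₁ b ≤ j → j ≤ j₂ b → StepRead shifts.toFinset (q : ℝ) (fun i₁ i₂ i μ => (αq i₁ i₂ i μ : ℝ)) Kb Ka (Eb : ℝ) (Et : ℝ)
      (fun k => (Mq k : ℝ)) (tOfV (rec b)) (nodeOfV Kb Ka (ωq b) (rec b))
      (fun y => secQ (qvec (n := m * winLen Kb Ka) (qz b)) (pxcoord Kb Ka (fun i k => (ωq b i k : ℝ)) y) = (lev b : ℝ) →
        ∃ (a' : ℝ) (z' : Fin m → ℤ → ℝ), 0 < a' ∧ (1 + (q : ℝ)) ^ (-((θn : ℝ) / (θd : ℝ))) ≤ a' ∧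
          (1 + (σ : ℝ)) * a' ≤ |y i₀ 1| ∧ Core z' ∧
          (∀ i k, -Kb ≤ k → k + 1 ≤ Ka → (wq k : ℝ) * |y i (1 + k) / a' - z' i k| ≤ (ρ : ℝ) * (r : ℝ)) ∧
          (∀ (i : Fin m) (v : ℝ), |v| ≤ (Et : ℝ) → (wq Ka : ℝ) * |v / a' - z' i Ka| ≤ (ρ : ℝ) * (r : ℝ)) ∧
          (∀ i, |y i (-Kb)| ≤ a' * (Zx : ℝ))) j :=
    fun b j hj1 hj2 => stepRead_readoutL_of_checksGJ hKb hKa hnd h𝕊 hq (hω b) (hcoef b) (hg b) (hs b j (by omega)) (hsec b j hj1 hj2)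
      (hread b j hj1 hj2) (hcoreL b j hj1 hj2)
  have key := hland_of_pbranchMeshes' (𝕊 := shifts.toFinset) (ε₀ := (q : ℝ)) (α := fun i₁ i₂ i μ => (αq i₁ i₂ i μ : ℝ)) (Kb := Kb) (Ka := Ka)
    (Eb := (Eb : ℝ)) (Et := (Et : ℝ)) (M := fun k => (Mq k : ℝ)) (Core := Core) (w := fun k => (wq k : ℝ)) (r := (r : ℝ))
    (Box := fun b S₀ => ∀ d, |pxcoord Kb Ka (fun i k => (ωq b i k : ℝ)) S₀ d - dvec (n := m * winLen Kb Ka) (rec b 0).x d| ≤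
      dvec (n := m * winLen Kb Ka) (rec b 0).r d)
    (t := fun b => tOfV (rec b)) (Node := fun b => nodeOfV Kb Ka (ωq b) (rec b))
    (Hull := fun b => hullOfG Kb Ka shifts (cB b) (ωq b) (rec b)) (ρ := (ρ : ℝ)) (θ₀ := (θn : ℝ) / (θd : ℝ)) (σ := (σ : ℝ))
    (c₀ := (c₀ : ℝ)) (Zx := (Zx : ℝ)) (i₀ := i₀)
    (sec := fun b y => secQ (qvec (n := m * winLen Kb Ka) (qz b)) (pxcoord Kb Ka (fun i k => (ωq b i k : ℝ)) y)) (lev := fun b => (lev b : ℝ))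
    (j₁ := j₁) (j₂ := j₂) hcover hj (fun b => tOfV_zero (rec b)) hmono hpos' hc₀'
    (fun b y hy => node0_of_boxV (hid b) (hE b) hy) hstep
    (fun b s S hrun => continuousOn_secQ_of_windowRun hKb hKa _ _ hrun)
    (fun b y hy => sec_lt_of_checkSecBelow (hbefore b) hy) (fun b y hy => le_sec_of_checkSecAbove (hafter b) hy) hread'
  exact key


end CertificateGlueOn

end Summit.NavierStokesRegularity.NavierStokesRegularity.Theorems
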